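import Summits.QuantumAdvantage.QuantumAdvantage.Theorems.CharDialSegmentMovesJ
import Summits.QuantumAdvantage.AdviceFreeQNC0.AffBells22WalkHardAllSubcube
import Summits.QuantumAdvantage.AdviceFreeQNC0.WindowLocalHard
import Summits.QuantumAdvantage.AdviceFreeQNC0.PredHard
import Summits.QuantumAdvantage.AdviceFreeQNC0.BlockCombJoin37
import HarnessLib

/-!
# CharDial — segment moves, part K: ★★ Young data are HARD (the Young slice of the blocker is decided, every assignment)

Support for `CharDial.WalkHardFJLinOdd` (stmt-QuantumAdvantage-32604), continuing part J.  The typed open cell of parts G–J (junta ⊕ form data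
whose forms are class-indicator forms of a common assignment `π`, juntas `≤ log₂ n`) is CLOSED, for every assignment and every prime `p ≥ 5`
(`young_hard`), by a DICHOTOMY on the class-size profile gluing two TREE engines by name:
* many free bits — free `min(#class, 4 log₂ n + 4)` coordinates per class and fix the rest; on each subcube the cut tables read `≤ 5 log₂ n + 4`
  free bits, so (junta-degree lemma `ind_mem_lowDeg_of_dependsOn`) they have `𝔽₂`-degree `≤ √N`, and the SUBCUBE tube-rank bound
  `Subcube.card_win_ext_le` + `failSet_ge_of_mem_fullSpan` (lineage AffBells22) caps the wins per subcube; DOUBLE COUNTING over the parallel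
  subcubes (`sum_card_filter_merge`: `Σ_a #{u : P(merge_W a u)} = 2ⁿ·#{w : P w}`) caps the total;
* few free bits — then few NON-EMPTY classes (each contributes a free bit), `≤ (m₀ + 81) log₂² n ≤ cubeRate n`; re-index them and apply the rank
  floor `youngForms_floor_rank` (part I, engine `cubeRank_hard`).
Corollary `comb_hard`: the comb family `combY` (parts D–F: on the HIGH side, outside the proved rank dial) wins on `≤ θ·2ⁿ` inputs.  WHAT THIS IS
NOT: the blocker has arbitrary dense coefficient vectors per cut with no common partition; such families admit no large common free set read
sparsely by every form and no low-dimensional span — they are untouched.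
-/

set_option autoImplicit false

namespace Summit.QuantumAdvantage.AdviceFreeQNC0.JLinPeel.SegMove

open Finset
open Summit.QuantumAdvantage.AdviceFreeQNC0

variable {n : ℕ} {p : ℕ}

-- the annex's `hasDeg_of_dependsOn'` ≡ the landed `BlockFibre37.hasDeg_of_dependsOn` (BlockCombJoin37) — imported, not restated (gate dedup p813382).

/-- **double counting over parallel subcubes**: `Σ_a #{u : P (merge_W a u)} = 2ⁿ · #{w : P w}` (the map `(a,u) ↦ (merge a u, merge u a)` is an
involution of the square of the cube). -/
theorem sum_card_filter_merge (W : Finset (Fin n)) (P : (Fin n → Bool) → Prop) [DecidablePred P] :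
    ∑ a : Fin n → Bool, (univ.filter fun u : Fin n → Bool => P (AffBells22.subcubeMerge W a u)).card
      = 2 ^ n * (univ.filter fun w : Fin n → Bool => P w).card := by
  let Φ : (Fin n → Bool) × (Fin n → Bool) → (Fin n → Bool) × (Fin n → Bool) :=
    fun q => (AffBells22.subcubeMerge W q.1 q.2, AffBells22.subcubeMerge W q.2 q.1)
  have hΦ : Function.Involutive Φ := by
    rintro ⟨a, u⟩
    simp only [Φ, Prod.mk.injEq]
    refine ⟨?_, ?_⟩ <;> funext i <;> by_cases hi : i ∈ W <;> simp [AffBells22.subcubeMerge, hi]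
  have h1 : ∀ a : Fin n → Bool, (univ.filter fun u : Fin n → Bool => P (AffBells22.subcubeMerge W a u)).card
      = ∑ u : Fin n → Bool, (if P (AffBells22.subcubeMerge W a u) then 1 else 0) := fun a => Finset.card_filter _ _
  simp_rw [h1]
  have h3 : (∑ a : Fin n → Bool, ∑ u : Fin n → Bool, (if P (AffBells22.subcubeMerge W a u) then 1 else 0))
      = ∑ q : (Fin n → Bool) × (Fin n → Bool), (if P (AffBells22.subcubeMerge W q.1 q.2) then 1 else 0) :=
    (Fintype.sum_prod_type' (fun a u => if P (AffBells22.subcubeMerge W a u) then (1 : ℕ) else 0)).symm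
  have h2 := hΦ.bijective.sum_comp (fun q : (Fin n → Bool) × (Fin n → Bool) => if P q.1 then (1 : ℕ) else 0)
  rw [h3]
  rw [show (∑ q : (Fin n → Bool) × (Fin n → Bool), (if P (AffBells22.subcubeMerge W q.1 q.2) then (1 : ℕ) else 0))
      = ∑ q : (Fin n → Bool) × (Fin n → Bool), (if P q.1 then (1 : ℕ) else 0) from h2]
  rw [Fintype.sum_prod_type, Finset.card_filter, Finset.mul_sum]
  refine Finset.sum_congr rfl fun a _ => ?_
  show (∑ _u : Fin n → Bool, (if P a then (1 : ℕ) else 0)) = _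
  rw [Finset.sum_const, Finset.card_univ, Fintype.card_fun, Fintype.card_bool, Fintype.card_fin, smul_eq_mul]

/-- ★★ **Young data are hard — every assignment, every prime `p ≥ 5`.**  Junta ⊕ form data (juntas `≤ log₂ n`) whose forms are scalar
multiples of class indicators of ANY assignment `π` (any number of classes, any sizes) win on `≤ θ·2ⁿ` inputs.  Dichotomy: many free bits ⇒
the subcube tube-rank engine (`𝔽₂`-degree `≤ 5 log₂ n + 4` in the free bits) + double counting; few ⇒ few non-empty classes ⇒ the rank floor. -/
theorem young_hard (p : ℕ) [Fact p.Prime] (hp5 : 5 ≤ p) :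
    ∃ θ : ℝ, θ < 1 ∧ ∃ n₀ : ℕ, ∀ n ≥ n₀, ∀ (c B : ℕ) (π : Fin n → Fin B) (D : JLinData p n),
      (∀ g, (D.J g).card ≤ Nat.log 2 n) → (∀ g, ∃ β : Fin B, ∃ l : ZMod p, D.a g = fun i => if π i = β then l else 0) →
        ((univ.filter fun u : Fin n → Bool => ringWinU c D.strat u = true).card : ℝ) ≤ θ * (2 : ℝ) ^ n := by
  obtain ⟨c₀, hc₀, m₀, hcore⟩ := failSet_ge_of_mem_fullSpan
  obtain ⟨θ₁, hθ₁, n₁, hn₁⟩ := youngForms_floor_rank p hp5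
  obtain ⟨N₀, hN₀⟩ := DWalk.const_mul_logPow_le' ((m₀ + 81) ^ 3) 11
  refine ⟨max (1 - c₀) θ₁, max_lt (by linarith) hθ₁, max n₁ (max N₀ 2), fun n hn c B π D hJ hY => ?_⟩
  have hnn₁ : n₁ ≤ n := le_trans (le_max_left _ _) hn
  have hnN₀ : N₀ ≤ n := le_trans (le_trans (le_max_left _ _) (le_max_right _ _)) hn
  have hn2 : 2 ≤ n := le_trans (le_trans (le_max_right _ _) (le_max_right _ _)) hn
  have h2n : (0 : ℝ) < (2 : ℝ) ^ n := by positivity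
  set L := Nat.log 2 n with hL
  have hL1 : 1 ≤ L := Nat.le_log_of_pow_le one_lt_two (by rw [pow_one]; exact hn2)
  set t := 4 * L + 4 with ht
  -- classes and their free parts
  set cls : Fin B → Finset (Fin n) := fun b => univ.filter fun i : Fin n => π i = b with hcls
  have hex : ∀ b, ∃ T ⊆ cls b, T.card = min (cls b).card t := fun b => Finset.exists_subset_card_eq (min_le_left _ _)
  choose Sb hSbsub hSbcard using hex
  set S : Finset (Fin n) := univ.biUnion Sb with hS
  set W : Finset (Fin n) := univ \ S with hW
  set N := S.card with hN
  have hdisj : ∀ b ∈ (univ : Finset (Fin B)), ∀ b' ∈ (univ : Finset (Fin B)), b ≠ b' → Disjoint (Sb b) (Sb b') := by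
    intro b _ b' _ hbb'
    exact Finset.disjoint_left.mpr fun i hi hi' =>
      hbb' ((mem_filter.mp (hSbsub b hi)).2.symm.trans (mem_filter.mp (hSbsub b' hi')).2)
  have hNsum : N = ∑ b, (Sb b).card := by rw [hN, hS, Finset.card_biUnion hdisj]
  have hWc : W.card + N = n := by
    have h := Finset.card_sdiff_add_card_eq_card (Finset.subset_univ S)
    rw [Finset.card_univ, Fintype.card_fin] at h
    exact h
  have hNW : n - W.card = N := by omega
  have hSb_cls : ∀ b, ∀ i ∈ Sb b, π i = b := fun b i hi => (mem_filter.mp (hSbsub b hi)).2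
  have hfree : ∀ i : Fin n, i ∉ W → i ∈ Sb (π i) := by
    intro i hi
    have hiS : i ∈ S := by
      by_contra h
      exact hi (Finset.mem_sdiff.mpr ⟨mem_univ _, h⟩)
    rw [hS, Finset.mem_biUnion] at hiS
    obtain ⟨b, _, hb⟩ := hiS
    have hπb : π i = b := hSb_cls b i hb
    rw [hπb]
    exact hb
  choose β l hβl using hY
  by_cases hA : max m₀ ((5 * L + 4) * (5 * L + 4)) ≤ N
  · -- DEGREE BRANCH: tube rank on every subcube `{u_W = a_W}`, then double counting
    have hm₀N : m₀ ≤ n - W.card := by rw [hNW]; exact le_trans (le_max_left _ _) hA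
    have hDN : 5 * L + 4 ≤ Nat.sqrt (n - W.card) := by
      rw [hNW, Nat.le_sqrt]
      exact le_trans (le_max_right _ _) hA
    have hdeg : ∀ (a : Fin n → Bool) (g : Fin (n + 1)),
        HasDeg (fun u => D.strat g (AffBells22.subcubeMerge W a u)) (5 * L + 4) := by
      intro a g
      have hK : (D.J g ∪ Sb (β g)).card ≤ 5 * L + 4 := by
        calc (D.J g ∪ Sb (β g)).card ≤ (D.J g).card + (Sb (β g)).card := Finset.card_union_le _ _
          _ ≤ L + t := add_le_add (hJ g) (by rw [hSbcard]; exact min_le_right _ _)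
          _ = 5 * L + 4 := by rw [ht]; ring
      refine BlockFibre37.hasDeg_of_dependsOn (D.J g ∪ Sb (β g)) hK fun u v huv => ?_
      have hmerge_J : ∀ i ∈ D.J g, AffBells22.subcubeMerge W a u i = AffBells22.subcubeMerge W a v i := by
        intro i hi
        unfold AffBells22.subcubeMerge
        by_cases hiW : i ∈ W
        · simp [hiW]
        · simp only [hiW, if_false]
          exact huv i (Finset.mem_union_left _ hi)
      have hform : form (D.a g) (AffBells22.subcubeMerge W a u) = form (D.a g) (AffBells22.subcubeMerge W a v) := by
        unfold form
        refine Finset.sum_congr rfl fun i _ => ?_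
        rw [hβl g]
        by_cases hπ : π i = β g
        · have hmi : AffBells22.subcubeMerge W a u i = AffBells22.subcubeMerge W a v i := by
            unfold AffBells22.subcubeMerge
            by_cases hiW : i ∈ W
            · simp [hiW]
            · simp only [hiW, if_false]
              have hi' : i ∈ Sb (β g) := by rw [← hπ]; exact hfree i hiW
              exact huv i (Finset.mem_union_right _ hi')
          rw [hmi]
        · simp [hπ]
      show D.h g (AffBells22.subcubeMerge W a u) (form (D.a g) (AffBells22.subcubeMerge W a u))
        = D.h g (AffBells22.subcubeMerge W a v) (form (D.a g) (AffBells22.subcubeMerge W a v))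
      rw [hform]
      exact D.hJ g _ _ hmerge_J _
    have hper : ∀ a : Fin n → Bool,
        ((univ.filter fun u : Fin n → Bool => ringWinU c D.strat (AffBells22.subcubeMerge W a u) = true).card : ℝ)
          ≤ (1 - c₀) * (2 : ℝ) ^ n := by
      intro a
      have h1 := Subcube.card_filter_merge_le W a (fun w => ringWinU c D.strat w = true)
      have h2 := Subcube.card_win_ext_le W a hcore hm₀N hDN c D.strat (hdeg a)
      have h1R : ((univ.filter fun u : Fin n → Bool => ringWinU c D.strat (AffBells22.subcubeMerge W a u) = true).card : ℝ)
          ≤ (2 : ℝ) ^ W.card *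
            ((univ.filter fun v : Fin (n - W.card) → Bool => ringWinU c D.strat (Subcube.ext W a v) = true).card : ℝ) := by
        exact_mod_cast h1
      have hpow : (2 : ℝ) ^ W.card * (2 : ℝ) ^ (n - W.card) = (2 : ℝ) ^ n := by
        rw [← pow_add, Subcube.card_add_sub]
      have h2' : (2 : ℝ) ^ W.card *
            ((univ.filter fun v : Fin (n - W.card) → Bool => ringWinU c D.strat (Subcube.ext W a v) = true).card : ℝ)
          ≤ (2 : ℝ) ^ W.card * ((1 - c₀) * (2 : ℝ) ^ (n - W.card)) := mul_le_mul_of_nonneg_left h2 (by positivity)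
      calc _ ≤ _ := h1R
        _ ≤ _ := h2'
        _ = (1 - c₀) * (2 : ℝ) ^ n := by rw [← hpow]; ring
    have hsum := sum_card_filter_merge W (fun w => ringWinU c D.strat w = true)
    have hsumR : (2 : ℝ) ^ n * ((univ.filter fun w : Fin n → Bool => ringWinU c D.strat w = true).card : ℝ)
        = ∑ a : Fin n → Bool,
            ((univ.filter fun u : Fin n → Bool => ringWinU c D.strat (AffBells22.subcubeMerge W a u) = true).card : ℝ) := by
      exact_mod_cast hsum.symm
    have hle : ∑ a : Fin n → Bool,
          ((univ.filter fun u : Fin n → Bool => ringWinU c D.strat (AffBells22.subcubeMerge W a u) = true).card : ℝ)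
        ≤ ∑ _a : Fin n → Bool, (1 - c₀) * (2 : ℝ) ^ n := Finset.sum_le_sum fun a _ => hper a
    rw [Finset.sum_const, Finset.card_univ, Fintype.card_fun, Fintype.card_bool, Fintype.card_fin, nsmul_eq_mul] at hle
    push_cast at hle
    rw [← hsumR] at hle
    have hwin : ((univ.filter fun w : Fin n → Bool => ringWinU c D.strat w = true).card : ℝ) ≤ (1 - c₀) * (2 : ℝ) ^ n :=
      le_of_mul_le_mul_left hle h2n
    exact le_trans hwin (mul_le_mul_of_nonneg_right (le_max_left _ _) h2n.le)
  · -- RANK BRANCH: few free bits ⇒ few non-empty classes ⇒ `youngForms_floor_rank` after re-indexing the non-empty classes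
    have hQ : N < max m₀ ((5 * L + 4) * (5 * L + 4)) := not_le.mp hA
    set T : Finset (Fin B) := univ.filter fun b => (cls b).Nonempty with hT
    have hmemT : ∀ i : Fin n, π i ∈ T := fun i =>
      mem_filter.mpr ⟨mem_univ _, ⟨i, mem_filter.mpr ⟨mem_univ _, rfl⟩⟩⟩
    have hTN : T.card ≤ N := by
      have h1 : ∀ b ∈ T, 1 ≤ (Sb b).card := by
        intro b hb
        rw [hSbcard]
        exact le_min (Finset.card_pos.mpr (mem_filter.mp hb).2) (by omega)
      calc T.card = ∑ b ∈ T, 1 := by simp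
        _ ≤ ∑ b ∈ T, (Sb b).card := Finset.sum_le_sum h1
        _ ≤ ∑ b, (Sb b).card :=
            Finset.sum_le_sum_of_subset_of_nonneg (Finset.subset_univ _) fun _ _ _ => Nat.zero_le _
        _ = N := hNsum.symm
    have hQcr : max m₀ ((5 * L + 4) * (5 * L + 4)) ≤ JLinPeel.cubeRate n := by
      have hL2 : 1 ≤ L ^ 2 := Nat.one_le_pow _ _ hL1
      have h54 : 5 * L + 4 ≤ 9 * L := by omega
      have hρ : max m₀ ((5 * L + 4) * (5 * L + 4)) ≤ (m₀ + 81) * L ^ 2 := by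
        apply max_le
        · calc m₀ = m₀ * 1 := (mul_one _).symm
            _ ≤ (m₀ + 81) * L ^ 2 := Nat.mul_le_mul (by omega) hL2
        · calc (5 * L + 4) * (5 * L + 4) ≤ 9 * L * (9 * L) := Nat.mul_le_mul h54 h54
            _ = 81 * L ^ 2 := by ring
            _ ≤ (m₀ + 81) * L ^ 2 := Nat.mul_le_mul_right _ (by omega)
      refine le_trans hρ (JLinPeel.le_cubeRate ?_ ?_)
      · calc (m₀ + 81) * L ^ 2 ≤ (m₀ + 81) ^ 3 * L ^ 11 :=
              Nat.mul_le_mul (Nat.le_self_pow (by norm_num) _) (Nat.pow_le_pow_right hL1 (by norm_num))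
          _ ≤ n := hN₀ n hnN₀
      · calc ((m₀ + 81) * L ^ 2) ^ 3 * L ^ 5 = (m₀ + 81) ^ 3 * L ^ 11 := by ring
          _ ≤ n := hN₀ n hnN₀
    have hTcr : T.card ≤ JLinPeel.cubeRate n := by omega
    -- re-index the non-empty classes
    let e : {b // b ∈ T} ≃ Fin T.card := T.equivFin
    let π' : Fin n → Fin T.card := fun i => e ⟨π i, hmemT i⟩
    have i₀ : Fin n := ⟨0, by omega⟩
    have hY' : ∀ g, ∃ β' : Fin T.card, ∃ l' : ZMod p, D.a g = fun i => if π' i = β' then l' else 0 := by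
      intro g
      by_cases hne : (cls (β g)).Nonempty
      · have hβT : β g ∈ T := mem_filter.mpr ⟨mem_univ _, hne⟩
        refine ⟨e ⟨β g, hβT⟩, l g, ?_⟩
        rw [hβl g]
        funext i
        have hiff : π i = β g ↔ π' i = e ⟨β g, hβT⟩ := by
          constructor
          · intro h
            show e ⟨π i, hmemT i⟩ = e ⟨β g, hβT⟩
            congr 1
            exact Subtype.ext h
          · intro h
            exact congrArg Subtype.val (e.injective h)
        by_cases hπ : π i = β g
        · rw [if_pos hπ, if_pos (hiff.mp hπ)]
        · rw [if_neg hπ, if_neg (fun h => hπ (hiff.mpr h))]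
      · refine ⟨π' i₀, 0, ?_⟩
        rw [hβl g]
        funext i
        have hπ : π i ≠ β g := fun h => hne ⟨i, mem_filter.mpr ⟨mem_univ _, h⟩⟩
        rw [if_neg hπ]
        split_ifs <;> rfl
    have key := hn₁ n hnn₁ c T.card π' hTcr D hJ hY'
    exact le_trans key (mul_le_mul_of_nonneg_right (le_max_right _ _) h2n.le)

/-- ★ and the comb family `combY` (the §37i inhabitant of HIGH outside the proved rank dial) is HARD for the player: for every prime `p ≥ 5`
there are `θ < 1`, `n₀` with `#WIN(c, combY p n) ≤ θ·2ⁿ` for all `n ≥ n₀` and every charge `c`. -/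
theorem comb_hard (p : ℕ) [hp : Fact p.Prime] (hp5 : 5 ≤ p) :
    ∃ θ : ℝ, θ < 1 ∧ ∃ n₀ : ℕ, ∀ n ≥ n₀, ∀ c : ℕ,
      ((univ.filter fun u : Fin n → Bool => ringWinU c (combY p n) u = true).card : ℝ) ≤ θ * (2 : ℝ) ^ n := by
  obtain ⟨θ, hθ, n₀, hn₀⟩ := young_hard p hp5
  obtain ⟨n₁, hn₁⟩ := eventually_mul_log_le (18 * p)
  refine ⟨θ, hθ, max n₀ n₁, fun n hn c => ?_⟩
  have h1 := hn₁ n (le_trans (le_max_right _ _) hn)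
  have hK0 : 0 < combK p n := combK_pos n
  have hB2 : 2 ≤ combB p n := by
    unfold combB
    rw [Nat.le_div_iff_mul_le hK0]
    have : combK p n = p * (8 * Nat.log 2 n + 9) := rfl
    nlinarith
  have hB : 0 < combB p n := by omega
  rw [← combData_strat]
  exact hn₀ n (le_trans (le_max_left _ _) hn) c (combB p n) (fun i => ⟨i.val % combB p n, Nat.mod_lt _ hB⟩)
    (combData p n) (fun g => by simp [combData]) (combData_young hB)

end Summit.QuantumAdvantage.AdviceFreeQNC0.JLinPeel.SegMove
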